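import Literature.MathematicalPhysics.QuantumFieldTheory.Balaban1983to89.B8Thm2TorusSupplier
import Literature.MathematicalPhysics.QuantumFieldTheory.Balaban1983to89.B8Eq142KLevelLocal
import Literature.MathematicalPhysics.QuantumFieldTheory.Balaban1983to89.B8Ineq165AllLevels
import Literature.MathematicalPhysics.QuantumFieldTheory.Balaban1983to89.B8Thm2TorusPointwise

/-!
# `Balaban1983to89.B8Thm2TorusSock142159` — [Balaban1985RegularSpaces] THEOREM 2 (p. 83) ON THE TORUS `Ω_j = T_η`: the two «algebraic»
# sockets of route P's supplier `B8Thm2TorusSupplier` — the (1.42)∕(1.37) clause `Sock142` (at every level `1 ≤ m ≤ k` with print's renamed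
# `α₁ = 11d²α₀ + α₁` of (1.66), and at the top level `k` with the `α₁` of (1.35)) and the in-edge (1.59) `Sock159` — DISCHARGED from
# (1.33)–(1.35) and from the b9 socket `B8LeafModelZd3.SockB9P3` at the truncation, by the landed `ℤᵈ` engines
# (sub-row «G-B8-T2S», route P, layer L4 §3 of `lit-balaban-t2s-1/J-SU-ROADMAP.md`)

statement-level skeleton of published theorems with citation tags; proofs where landed; nothing here is a claim about the
Yang–Mills mass gap

T. Bałaban, *Spaces of regular gauge field configurations on a lattice and gauge fixing conditions*, Commun. Math. Phys. **99** (1985)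
75–102 `[Balaban1985RegularSpaces]` ("B8"; printed page = PDF page + 74): (1.37) p. 82, (1.42) p. 83 («|Q_j(U₀, ηA)| < 2dLα₁ on Λ_j»),
(1.65)–(1.66) p. 87 («Thus the conditions (1.33)–(1.35) imply |Ũ′ʲ − 1| < 11d²α₀ + α₁ … For simplicity let us write α₁ instead of the
right-hand side»), (1.59) p. 86 («Theorem 3.3 of [4] implies the bounds |A|₍₋₁₎, |∇^η_{U₀}A|₍₋₂₎, |Δ^η_{U₀}A|₍₋₃₎, ‖A‖_{1,β,(−2−β)} ≦
B₀(|J|₍₋₃₎ + |B₁|)»), p. 77 («Ω_j = T_η for j = 0,1,…,l, l ≤ k»).  [4] = `[Balaban1985BackgroundPropagators]` Thm 3.3 p. 398.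
STATUS: published, refereed.  PDF held: `paper:balaban1985-cmp99-regular-spaces-gauge-fixing`, pp. 82–83, 86–89 read on the text layer.

CITATION HEADER (lean-in-tree rule).  Cell `lit-balaban`, seat `lit-balaban-t2s-1` (gen 2), sub-row «G-B8-T2S» = the [B8] §3 THEOREM 2 TORUS
SUPPLIER for R3 `stmt-QuantumFields-19200` (`--supports`, helper).  WHAT IS REPRODUCED.  Two of the six conjuncts of
`B8Thm2TorusSupplier.Thm2TorusSockets` were still hypotheses after gen 0 (`J-SU-ROADMAP.md` §STATE AT SESSION END: «NOT YET: Sock142 (×2) …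
Sock159»).  This file serves them BY NAME from the landed `ℤᵈ` engines:
* §1 torus bookkeeping (`Type*`-polymorphic copies of two five-line readers of `B8Thm2TorusBridge`, whose carrier is pinned to `Type`):
  every level-`ℓ` block lies under a site of the top lattice (`torusLam_h16`), (1.34)-axial at the top truncation gives it at every
  truncation (`inAx_torusLam_all`), and **(1.65) ⇒ (1.66) AT EVERY LEVEL on `T_η`** (`h135_allLevels` =
  `B8Ineq165AllLevels.norm_avg_sub_le_allLevels_of135` at `Ω_j = ℤᵈ`, `Λ = torusLam k`, (1.35) read on the top lattice).
* §2 **`sock142_of135`** — `Sock142 L P η (11d²α₀ + α₁) g G U₀ U′ m` for EVERY `1 ≤ m ≤ k`, and **`sock142_top`** — `Sock142 L P η α₁ g G U₀ U′ k`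
  with the `α₁` of (1.35): the (1.42) lemma `B8Eq142KLevelLocal.H42_interior_of_inAx` (interior constraint bonds: on the torus every
  constraint bond has both ends in `Λ_m = T^{(m)}`), fed with (1.66) at every level (§1) resp. with (1.35) at level `k`.
* §3 **`sock159_of_sockB9P3`** — `Sock159 L P η 0 B₀ (2B₀) g len G U₀ U′ m` (Hölder datum `β₀ = 0`) from `SockB9P3 … m` at the truncation `m`:
  the gauge-fixed field `W = U′^{u⁻¹}` is unitary and `WU₀ ∈ 𝔄_m` by gauge invariance (`B8Ineq132.inAk_gaugeAct_iff`), the b9 socket gives the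
  four weighted lines, the weighted suprema are read pointwise at the top weight (bounded families: the crude bounds of
  `B8Thm2TorusPointwise`), the `β = 0` Hölder quotient of (3.40) is the plain oscillation `‖R(U₀(Γ))F(x′) − F(x)‖ ≤ 2 sup‖F‖` (transport
  isometric, `B9Eq340HolderZd.norm_trans`), whence the constant `2B₀`; the bond set of (1.56) in the two spellings of record
  (`B8Thm2TorusMember.torusLamb m` = `bondsOn (torusLam m)`, `torusLamb_eq_bondsOn`).

## HONEST SCOPE
(i) No new analysis: (1.42) is the landed box lemma, (1.66) the landed all-levels lemma, (1.59) stays the b9 socket `SockB9P3` ([4] Thm 3.3 in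
Proposition 3's frame, a hypothesis quantified over all unitary backgrounds of the class on `ℤᵈ` — the deliverable of sub-row «G-B9-LETTERS»).
(ii) Hölder datum `β₀ = 0` only (as route K, `B8Thm2TorusAtSupplier`); the genuine `β`-Hölder line of the b9 socket is not read.  (iii) `d ≥ 2`,
`L ≥ 2`, `G ≤ U(𝔸)`, `𝔸` a C⋆-algebra.  Count-neutral; N05 ∕ `stub_PV3A` NOT discharged; Theorem 2 is NOT claimed here; nothing continuum ∕ ℝ⁴ ∕
OS ∕ mass-gap ∕ Clay.  No `sorry`, no `def`, no `… : Prop` fact, no `instance`, no `notation`.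
-/

noncomputable section

open NormedSpace

namespace Literature.MathematicalPhysics.QuantumFieldTheory.Balaban1983to89.B8Thm2TorusSock142159

open B7Prop1Explicit B7Prop2Explicit B7Prop1Local B7Eq92Concrete
open B7Prop2Explicit (C0 c2')
open B7Prop3Flat (c3)
open B8Lemma1NonAbelian (mulCfg)
open B8Ineq132 (covDerivFwd InAk BondTouches Under)
open B8Eq119TwistedAxial (Restr129 InAx)
open B8Eq184Proof (cfgExp)
open B8Eq140Level (SideTouches)
open B8Eq138LandauZd (IsLandau138W covLap)
open B8Eq146AExpansion (iEta plaqCovDeriv)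
open B8Eq143PlaqExpansion (pdiv)
open B7Prop4GeneralLevels (logCovIter linCovIter)
open B8Eq155JBound (Jcur wsup norm_covDerivFwd_le_of_141)
open B8ScaledSupNorm (msup bondNorm weight Bdd bdd_of_forall weight_mul_norm_le_msup weight_neg_natCast scale_pos)
open B9Eq340HolderZd (hquot AdmPair norm_trans)
open B8Eq133Hypotheses (Hyp135)
open B8Eq113ClassBk (bondsOn mem_bondsOn)
open B8Ineq130 (tlo thi)
open B8Ineq166Univ (under_add_of_under)
open B8Thm4TorusAt (torusLam mem_torusLam_iff)
open B8Thm2TorusAt (Cond135T hyp135_torusLam_iff)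
open B8Thm2TorusMember (exists_under torusLamb mem_torusLamb_iff bondTouches_torusLam_iff)
open B8LeafModelZd3 (SockB9P3)
open B8Thm2TorusSupplier (Sock142 Sock159 Lines159 rhs159 alpha1e sideTouches_univ eq_of_mem_bondsOn_torusLam
  mem_bondsOn_torusLam_self bound_anti_level₁)
open B8Eq142KLevelLocal (H42_interior_of_inAx)
open B8Ineq165AllLevels (norm_avg_sub_le_allLevels_of135)
open B8Thm2TorusPointwise (norm_pdiv_le_of_forall norm_covLap_le_of_forall)

-- `Site` alone could resolve to the torus sites of `Setup.lean`; re-export the `ℤ^d` sites of `B7Prop1Explicit`.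
export B7Prop1Explicit (Site)

variable {d : ℕ}

/-! ## §1 Torus bookkeeping: blocks under the top lattice, (1.34)-axial at every truncation, (1.66) at every level -/

section Bookkeeping

/-- **Every level-`ℓ` block of `ℤᵈ` lies in the tower of a site of the top lattice `Λ_k = T^{(k)}`** (print's (1.6) «Ω_ℓ^{(ℓ)} = Λ_ℓ ∪
B(Ω_{ℓ+1}^{(ℓ+1)})» for `Ω_j = T_η`: `Λ_j = ∅` below `k`) — the geometric premise `h16` of `B8Ineq165AllLevels.norm_avg_sub_le_allLevels_of135`
for `Λ = torusLam k` (`B8Thm2TorusMember.exists_under`). [cite: Balaban1985RegularSpaces, (1.5)–(1.6) p.77, p.77 («Ω_j = T_η for j = 0,1,…,l, l ≤ k»)] -/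
theorem torusLam_h16 {L : ℕ} (hL : 1 ≤ L) (k : ℕ) :
    ∀ ℓ, ℓ ≤ k → ∀ w : Site d, (∀ x, InBox (tlo L w ℓ) (thi L w ℓ) x → x ∈ (fun _ : ℕ => (Set.univ : Set (Site d))) ℓ) →
      ∃ j, ℓ ≤ j ∧ j ≤ k ∧ ∃ y ∈ torusLam (d := d) k j, Under L (j - ℓ) y w := by
  intro ℓ hℓ w _
  obtain ⟨y, hy⟩ := exists_under hL (k - ℓ) w
  exact ⟨k, hℓ, le_rfl, y, (mem_torusLam_iff k k y).2 rfl, hy⟩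

variable {𝔸 : Type*} [CStarAlgebra 𝔸]

/-- **(1.34)-axial at the top truncation gives it at every truncation `m ≤ k`** on the torus constraint sequences: (1.19) below a site of
`Λ_m = T^{(m)}` at the levels `n < m` is (1.19) below its level-`k` ancestor in `Λ_k = T^{(k)}` (blocks compose) — the `Type*`-polymorphic copy
of `B8Thm2TorusBridge.inAx_torusLam_of_top`. [cite: Balaban1985RegularSpaces, (1.19) p.79, (1.34) p.82, (1.28) p.81] -/
theorem inAx_torusLam_all {L k : ℕ} (hL : 1 ≤ L) {U₀ W : Site d → Fin d → 𝔸ˣ} (h : InAx L k (torusLam k) U₀ W) :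
    ∀ m, m ≤ k → InAx L m (torusLam (d := d) m) U₀ W := by
  intro m hm j hj1 hjm xj hxj n hn z hz r
  have hj : j = m := (mem_torusLam_iff m j xj).1 hxj
  subst hj
  obtain ⟨y, hy⟩ := exists_under hL (k - j) xj
  have hz' : Under L (k - (n + 1)) y z := by
    have h' := under_add_of_under hy hz
    have e : k - j + (j - (n + 1)) = k - (n + 1) := by omega
    rwa [e] at h'
  exact h k (le_trans hj1 hm) le_rfl y ((mem_torusLam_iff k k y).2 rfl) n (by omega) z hz' r

variable [Nontrivial 𝔸]

/-- **(1.65) ⇒ (1.66) AT EVERY LEVEL ON THE TORUS** (p. 87 «Thus the conditions (1.33)–(1.35) imply |Ũ′ʲ − 1| < 11d²α₀ + α₁ on Ω_j^{(j)}»,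
all `j = 0, …, k`): from (1.33) `U₀ ∈ 𝔄_k({T_η}, α₀)`, (1.34) `U′U₀ ∈ 𝔄_k({T_η}, α₀) ∩ Ax_k(𝔅_k, U₀)` and (1.35) on the top lattice
(`Hyp135 L k (torusLam k) α₁`), under the windows of (1.65): `‖(U′U₀)‾ʲ_b − Ū₀ʲ_b‖ ≤ 11d²α₀ + α₁` at EVERY level-`j` bond `b`, `j ≤ k` —
`B8Ineq165AllLevels.norm_avg_sub_le_allLevels_of135` at `Ω_j = ℤᵈ`, `Λ = torusLam k` (geometric premise `torusLam_h16`).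
[cite: Balaban1985RegularSpaces, (1.65)–(1.66) p.87, (1.33)–(1.35) p.82, (1.6) p.77] -/
theorem h135_allLevels (hd : 1 ≤ d) {L : ℕ} (hL : 2 ≤ L) (k : ℕ) {η : ℝ} {U₀ U' : Site d → Fin d → 𝔸ˣ}
    (hU₀ : ∀ x κ, U₀ x κ ∈ unitaryUnits 𝔸) (hU' : ∀ x κ, U' x κ ∈ unitaryUnits 𝔸)
    {α₀ α₁ : ℝ} (hα₀ : 0 < α₀) (hα3 : C0 d * α₀ ≤ 1 / 3) (hα2 : 2 * α₀ ≤ c2' d L) (hα₁ : 0 < α₁)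
    (h6 : alpha1e d α₀ α₁ ≤ 1 / 6)
    (h33 : InAk L k η α₀ (fun _ => (Set.univ : Set (Site d))) U₀)
    (h34 : InAk L k η α₀ (fun _ => (Set.univ : Set (Site d))) (mulCfg U' U₀))
    (hAx : InAx L k (torusLam k) U₀ (mulCfg U' U₀)) (h35 : Hyp135 L k (torusLam k) α₁ U₀ U') :
    ∀ j, j ≤ k → ∀ (z : Site d) (μ : Fin d),
      ‖(avgIter L (mulCfg U' U₀) j z μ : 𝔸) - (avgIter L U₀ j z μ : 𝔸)‖ ≤ alpha1e d α₀ α₁ := by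
  intro j hj z μ
  have hc : Cond135T L k U₀ U' α₁ := (hyp135_torusLam_iff L k U₀ U' α₁).1 h35
  have h35' : ∀ j, j ≤ k → ∀ (z : Site d) (μ : Fin d), BondTouches (torusLam (d := d) k j) z μ →
      (∀ x, InBox (loK L j z) (bondHiK L j z μ) x → x ∈ (fun _ : ℕ => (Set.univ : Set (Site d))) j) →
      ‖(avgIter L (mulCfg U' U₀) j z μ : 𝔸) - (avgIter L U₀ j z μ : 𝔸)‖ ≤ α₁ := by
    intro j _ z μ hb _
    have hjk : j = k := (bondTouches_torusLam_iff k j z μ).1 hb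
    subst hjk
    exact (hc z μ).le
  unfold alpha1e at h6 ⊢
  exact norm_avg_sub_le_allLevels_of135 hd hL k hU₀ hU' hα₀ hα3 hα2 hα₁.le h6 (fun _ => Set.univ) (fun _ => subset_rfl)
    (torusLam k) (fun _ _ _ _ _ _ => Set.mem_univ _) (torusLam_h16 (le_trans one_le_two hL) k) h33 h34 hAx h35' hj z μ
    (fun _ _ => Set.mem_univ _)

end Bookkeeping

/-! ## §2 The (1.42) socket `Sock142` on the torus, at every level (renamed `α₁`) and at the top level (the `α₁` of (1.35)) -/

section S142

variable {𝔸 : Type*} [CStarAlgebra 𝔸] [Nontrivial 𝔸]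

/-- **THE (1.42) SOCKET OF ROUTE P AT EVERY LEVEL `1 ≤ m ≤ k`, WITH PRINT'S RENAMED `α₁ = 11d²α₀ + α₁` OF (1.66), FROM (1.33)–(1.35)**
(«|Q_j(U₀, ηA)| < 2dLα₁ on Λ_j», p. 83, «basically of an algebraic character and it follows from the construction»; p. 87 «let us write α₁
instead of the right-hand side»): for a `G`-valued pair (`G ≤ U(𝔸)`) in Theorem 2's regime on `T_η` — (1.33), (1.34) (`InAk` ×2, `InAx` at the top
truncation), (1.35) on the top lattice — under [3]'s Prop.-1∕2∕4 windows for `α₀`, the windows of the box lemma at the guard `g` (`16g ≤ 1`, the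
exponential window, `2g ≤ c₃`), (1.65)'s `11d²α₀ + α₁ ≤ 1/6` and `dL(11d²α₀ + α₁) ≤ 1/8`:
`B8Thm2TorusSupplier.Sock142 L P η (11d²α₀ + α₁) g G U₀ U′ m`.  PROOF: `B8Eq142KLevelLocal.H42_interior_of_inAx` at `Ω_j = ℤᵈ`,
`Λs = torusLam`, `Λb m = bondsOn (torusLam m)` (interior bonds: both ends in `T^{(m)}`), fed with (1.66) at every level (`h135_allLevels`) and
(1.34)-axial at every truncation (`inAx_torusLam_all`). [cite: Balaban1985RegularSpaces, (1.42) p.83, (1.37) p.82, p.83, (1.65)–(1.66) p.87, (1.29) p.81, (1.19) p.79] -/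
theorem sock142_of135 (hd2 : 2 ≤ d) {η : ℝ} (hη : 0 < η) {L : ℕ} (hL : 2 ≤ L) (k : ℕ) {P : ℤ} {G : Subgroup 𝔸ˣ}
    (hGu : G ≤ unitaryUnits 𝔸) {U₀ U' : Site d → Fin d → 𝔸ˣ} (hU₀G : ∀ x κ, U₀ x κ ∈ G) (hU'G : ∀ x κ, U' x κ ∈ G)
    {α₀ α₁ g : ℝ} (hα₀ : 0 < α₀) (hα₁ : 0 < α₁) (hg : 0 ≤ g)
    (hα3 : C0 d * α₀ ≤ 1 / 3) (hα4 : 4 * α₀ ≤ c2' d L) (h16 : 16 * g ≤ 1)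
    (hsmall : Real.exp (4 * (800 * ((d : ℝ) + 1) ^ 2 * ((d : ℝ) + 4)) * α₀) * (1 + 8 * (131072 * ((d : ℝ) + 1) ^ 2) * g) ≤ 2)
    (hc₃ : 2 * g ≤ c3 d L) (h6 : alpha1e d α₀ α₁ ≤ 1 / 6) (hsmall₁ : (d : ℝ) * L * alpha1e d α₀ α₁ ≤ 1 / 8)
    (h33 : InAk L k η α₀ (fun _ => (Set.univ : Set (Site d))) U₀)
    (h34 : InAk L k η α₀ (fun _ => (Set.univ : Set (Site d))) (U' * U₀))
    (hAx : InAx L k (torusLam k) U₀ (U' * U₀)) (h35 : Hyp135 L k (torusLam k) α₁ U₀ U') :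
    ∀ m, 1 ≤ m → m ≤ k → Sock142 L P η (alpha1e d α₀ α₁) g G U₀ U' m := by
  intro m hm1 hmk u W A huG _ hW h129 _ hsa hWe hbd x ν
  have hL1 : 1 ≤ L := le_trans one_le_two hL
  have hd1 : 1 ≤ d := le_trans one_le_two hd2
  have hU₀ : ∀ x κ, U₀ x κ ∈ unitaryUnits 𝔸 := fun x κ => hGu (hU₀G x κ)
  have hU' : ∀ x κ, U' x κ ∈ unitaryUnits 𝔸 := fun x κ => hGu (hU'G x κ)
  have hu : ∀ x, u x ∈ unitaryUnits 𝔸 := fun x => hGu (huG x)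
  have hα2 : 2 * α₀ ≤ c2' d L := by linarith
  have hαe : 0 < alpha1e d α₀ α₁ := by unfold alpha1e; positivity
  -- (1.34)-axial at every truncation, (1.66) at every level
  have hAx' : ∀ m', m' ≤ k → InAx L m' (torusLam (d := d) m') U₀ (mulCfg U' U₀) := inAx_torusLam_all hL1 hAx
  have h135 := h135_allLevels hd1 hL k hU₀ hU' hα₀ hα3 hα2 hα₁ h6 h33 h34 hAx h35
  -- the datum in the engine's currency: the level-`m` bound serves every `j ≤ m`; every bond touches `T_η`
  have hWA : ∀ j, j ≤ m → ∀ (y : Site d) (τ : Fin d), SideTouches ((fun _ : ℕ => (Set.univ : Set (Site d))) j) y τ →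
      W y τ = cfgExp η A y τ ∧ ‖A y τ‖ ≤ g * ((L : ℝ) ^ j * η)⁻¹ :=
    fun j hj y τ _ => ⟨hWe y τ, (hbd y τ).trans (bound_anti_level₁ hL1 hη hg hj)⟩
  have hA0 : ∀ (y : Site d) (τ : Fin d), (∀ j, j ≤ m → ¬ SideTouches ((fun _ : ℕ => (Set.univ : Set (Site d))) j) y τ) → A y τ = 0 :=
    fun y τ h => absurd (sideTouches_univ hd2 y τ) (h 0 (Nat.zero_le _))
  exact H42_interior_of_inAx hd2 hη hL k hU₀ hα₀ hαe hg hα3 hα4 h16 hsmall hc₃ hsmall₁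
    (fun _ => (Set.univ : Set (Site d))) (fun m' => torusLam (d := d) m') (fun m' j => bondsOn (torusLam (d := d) m') j)
    (fun _ _ _ _ _ _ _ _ => Set.mem_univ _)
    (fun m' _ j _ c hc => by
      obtain rfl : j = m' := eq_of_mem_bondsOn_torusLam hc
      exact ⟨(mem_torusLam_iff j j _).2 rfl, (mem_torusLam_iff j j _).2 rfl⟩)
    h33 hAx'
    (fun m' hm' j _ c hc => by
      obtain rfl : j = m' := eq_of_mem_bondsOn_torusLam hc
      exact h135 j hm' c.1 c.2)
    (fun _ _ => True) m hm1 hmk u W A hu hW h129 trivial hsa hWA hA0 m le_rfl (x, ν) (mem_bondsOn_torusLam_self m (x, ν))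

/-- **THE (1.42) SOCKET OF ROUTE P AT THE TOP LEVEL `k`, WITH THE `α₁` OF (1.35)** («Q_j(U₀, ηA) = B on Λ_j … |B| < 2dLα₁ by the
assumption (1.35)», (1.37) p. 82): for a `G`-valued pair in Theorem 2's regime on `T_η` — (1.33), (1.34)-axial at the top truncation, (1.35)
on the top lattice — under the windows of the box lemma at the guard `g` and `dLα₁ ≤ 1/8`: `B8Thm2TorusSupplier.Sock142 L P η α₁ g G U₀ U′ k`.
PROOF: `B8Eq142KLevelLocal.H42_interior_of_inAx` with the constraint-bond family «level `k` of the top truncation only», where (1.35) is the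
hypothesis verbatim. [cite: Balaban1985RegularSpaces, (1.37) p.82, (1.42) p.83, (1.35) p.82, (1.29) p.81] -/
theorem sock142_top (hd2 : 2 ≤ d) {η : ℝ} (hη : 0 < η) {L : ℕ} (hL : 2 ≤ L) {k : ℕ} (hk : 1 ≤ k) {P : ℤ} {G : Subgroup 𝔸ˣ}
    (hGu : G ≤ unitaryUnits 𝔸) {U₀ U' : Site d → Fin d → 𝔸ˣ} (hU₀G : ∀ x κ, U₀ x κ ∈ G)
    {α₀ α₁ g : ℝ} (hα₀ : 0 < α₀) (hα₁ : 0 < α₁) (hg : 0 ≤ g)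
    (hα3 : C0 d * α₀ ≤ 1 / 3) (hα4 : 4 * α₀ ≤ c2' d L) (h16 : 16 * g ≤ 1)
    (hsmall : Real.exp (4 * (800 * ((d : ℝ) + 1) ^ 2 * ((d : ℝ) + 4)) * α₀) * (1 + 8 * (131072 * ((d : ℝ) + 1) ^ 2) * g) ≤ 2)
    (hc₃ : 2 * g ≤ c3 d L) (hsmall₁ : (d : ℝ) * L * α₁ ≤ 1 / 8)
    (h33 : InAk L k η α₀ (fun _ => (Set.univ : Set (Site d))) U₀)
    (hAx : InAx L k (torusLam k) U₀ (U' * U₀)) (h35 : Hyp135 L k (torusLam k) α₁ U₀ U') :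
    Sock142 L P η α₁ g G U₀ U' k := by
  intro u W A huG _ hW h129 _ hsa hWe hbd x ν
  have hL1 : 1 ≤ L := le_trans one_le_two hL
  have hU₀ : ∀ x κ, U₀ x κ ∈ unitaryUnits 𝔸 := fun x κ => hGu (hU₀G x κ)
  have hu : ∀ x, u x ∈ unitaryUnits 𝔸 := fun x => hGu (huG x)
  have hc : Cond135T L k U₀ U' α₁ := (hyp135_torusLam_iff L k U₀ U' α₁).1 h35
  have hAx' : ∀ m', m' ≤ k → InAx L m' (torusLam (d := d) m') U₀ (mulCfg U' U₀) := inAx_torusLam_all hL1 hAx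
  have hWA : ∀ j, j ≤ k → ∀ (y : Site d) (τ : Fin d), SideTouches ((fun _ : ℕ => (Set.univ : Set (Site d))) j) y τ →
      W y τ = cfgExp η A y τ ∧ ‖A y τ‖ ≤ g * ((L : ℝ) ^ j * η)⁻¹ :=
    fun j hj y τ _ => ⟨hWe y τ, (hbd y τ).trans (bound_anti_level₁ hL1 hη hg hj)⟩
  have hA0 : ∀ (y : Site d) (τ : Fin d), (∀ j, j ≤ k → ¬ SideTouches ((fun _ : ℕ => (Set.univ : Set (Site d))) j) y τ) → A y τ = 0 :=
    fun y τ h => absurd (sideTouches_univ hd2 y τ) (h 0 (Nat.zero_le _))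
  exact H42_interior_of_inAx hd2 hη hL k hU₀ hα₀ hα₁ hg hα3 hα4 h16 hsmall hc₃ hsmall₁
    (fun _ => (Set.univ : Set (Site d))) (fun m' => torusLam (d := d) m') (fun m' j => {_c | m' = k ∧ j = k})
    (fun _ _ _ _ _ _ _ _ => Set.mem_univ _)
    (fun m' _ j _ c hc => by
      obtain ⟨rfl, rfl⟩ := hc
      exact ⟨(mem_torusLam_iff _ _ _).2 rfl, (mem_torusLam_iff _ _ _).2 rfl⟩)
    h33 hAx'
    (fun m' _ j _ c hc => by
      obtain ⟨rfl, rfl⟩ := hc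
      exact (hc c.1 c.2).le)
    (fun _ _ => True) k hk le_rfl u W A hu hW h129 trivial hsa hWA hA0 k le_rfl (x, ν) ⟨rfl, rfl⟩

end S142

/-! ## §3 The (1.59) socket `Sock159` on the torus from the b9 socket at the truncation (Hölder datum `β₀ = 0`) -/

section S159

variable {𝔸 : Type*} [CStarAlgebra 𝔸] [Nontrivial 𝔸]

omit [CStarAlgebra 𝔸] [Nontrivial 𝔸] in
/-- **The constraint-bond set of (1.56) in its two spellings of record**: `B8Thm2TorusMember.torusLamb m j` (all bonds of the top lattice `j = m`,
none below) IS `bondsOn (torusLam m) j` (the bonds with an end in `Λ_j`, `Λ = torusLam m`). [cite: Balaban1985RegularSpaces, (1.56) p.86, (1.28) p.81, p.77 (bond convention)] -/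
theorem torusLamb_eq_bondsOn (m : ℕ) : torusLamb (d := d) m = fun j => bondsOn (torusLam (d := d) m) j := by
  funext j
  ext c
  rw [mem_torusLamb_iff]
  constructor
  · rintro rfl
    exact mem_bondsOn_torusLam_self j c
  · intro hc
    exact eq_of_mem_bondsOn_torusLam hc

/-- **THE (1.59) SOCKET OF ROUTE P AT THE TRUNCATION `m ≤ k` FROM THE b9 SOCKET, HÖLDER DATUM `β₀ = 0`** («Theorem 3.3 of [4] implies the bounds
|A|₍₋₁₎, |∇^η_{U₀}A|₍₋₂₎, |Δ^η_{U₀}A|₍₋₃₎, ‖A‖_{1,β,(−2−β)} ≦ B₀(|J|₍₋₃₎ + |B₁|)», p. 86): for a `G`-valued pair (`G ≤ U(𝔸)`) with (1.33)∕(1.34)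
`U₀, U′U₀ ∈ 𝔄_k({T_η}, α₀)` and the b9 socket `SockB9P3 L B₀ B₀β c_{b9} β len η m {ℤᵈ} torusLam torusLamb` with `α₀, g ≤ c_{b9}`:
`B8Thm2TorusSupplier.Sock159 L P η 0 B₀ (2B₀) g len G U₀ U′ m`.  PROOF: the gauge-fixed field `W = U′^{u⁻¹}` of a `Sock159` datum is unitary and
`WU₀ = (U′U₀)^{u⁻¹} ∈ 𝔄_m` (gauge invariance of (1.7)); the b9 socket at `(α₀, α₂ := g, U₀, W, A)` gives the four weighted lines; they are read
pointwise at the top weight `(Lᵐη)ᵖ` (bounded families by the crude bounds of a bounded exponent field); the `β = 0` member of the Hölder line is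
`(Lᵐη)²‖R(U₀(Γ))(DA)(x′) − (DA)(x)‖ ≤ 2B₀(|J|₍₋₃₎ + |B₁|)` from the gradient line at both points (transport isometric).
[cite: Balaban1985RegularSpaces, (1.59) p.86, (1.55)–(1.57) p.86, (1.17) p.78; Balaban1985BackgroundPropagators, Thm 3.3 p.399, (3.40) p.397] -/
theorem sock159_of_sockB9P3 (hd2 : 2 ≤ d) {η : ℝ} (hη : 0 < η) {L : ℕ} (hL : 2 ≤ L) {k : ℕ} {P : ℤ} {G : Subgroup 𝔸ˣ}
    (hGu : G ≤ unitaryUnits 𝔸) {U₀ U' : Site d → Fin d → 𝔸ˣ} (hU₀G : ∀ x κ, U₀ x κ ∈ G) (hU'G : ∀ x κ, U' x κ ∈ G)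
    {α₀ g B₀ B₀β cB9 β : ℝ} {len : Site d → ℝ} (hα₀ : 0 < α₀) (hg : 0 < g) (hα₀9 : α₀ ≤ cB9) (hg9 : g ≤ cB9) (hB₀ : 0 ≤ B₀)
    (h33 : InAk L k η α₀ (fun _ => (Set.univ : Set (Site d))) U₀)
    (h34 : InAk L k η α₀ (fun _ => (Set.univ : Set (Site d))) (U' * U₀))
    {m : ℕ} (hmk : m ≤ k)
    (SB9 : SockB9P3 (𝔸 := 𝔸) L B₀ B₀β cB9 β len η m (fun _ => (Set.univ : Set (Site d))) (fun m' => torusLam (d := d) m')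
      (fun m' => torusLamb (d := d) m')) :
    Sock159 L P η 0 B₀ (2 * B₀) g len G U₀ U' m := by
  intro u W A huG _ hW _ hLan hsa hWe hbd
  have hL1 : 1 ≤ L := le_trans one_le_two hL
  have hLr : (1 : ℝ) ≤ L := by exact_mod_cast hL1
  have hU₀ : ∀ x κ, U₀ x κ ∈ unitaryUnits 𝔸 := fun x κ => hGu (hU₀G x κ)
  have hU' : ∀ x κ, U' x κ ∈ unitaryUnits 𝔸 := fun x κ => hGu (hU'G x κ)
  have hu : ∀ x, u x ∈ unitaryUnits 𝔸 := fun x => hGu (huG x)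
  have hU₀1 : ∀ x κ, U₀ x κ ∈ U1 𝔸 := fun x κ => unitaryUnits_le_U1 (hU₀ x κ)
  -- the gauge-fixed field `W = U′^{u⁻¹}`: unitary, `WU₀ ∈ 𝔄_m({T_η}, α₀)` by gauge invariance
  have hWu : ∀ x κ, W x κ ∈ unitaryUnits 𝔸 := B8Prop3GaugeFixedKLevel.mem_unitaryUnits_of_mgauge_eq hU₀ hU' hu hW
  have h33m : InAk L m η α₀ (fun _ => (Set.univ : Set (Site d))) U₀ := fun j hj => h33 j (hj.trans hmk)
  have h34W : InAk L m η α₀ (fun _ => (Set.univ : Set (Site d))) (mulCfg W U₀) := by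
    have h1 : InAk L m η α₀ (fun _ => (Set.univ : Set (Site d))) (mulCfg U' U₀) := fun j hj => h34 j (hj.trans hmk)
    have hui : ∀ x, u⁻¹ x ∈ U1 𝔸 := fun x => unitaryUnits_le_U1 ((unitaryUnits 𝔸).inv_mem (hu x))
    rw [B8Prop3GaugeFixedKLevel.mulCfg_eq_gaugeAct_of_mgauge_eq hW]
    exact (B8Ineq132.inAk_gaugeAct_iff L m η α₀ _ hui _).2 h1
  -- the datum in the b9 socket's currency
  have hWA : ∀ j, j ≤ m → ∀ (y : Site d) (τ : Fin d), SideTouches ((fun _ : ℕ => (Set.univ : Set (Site d))) j) y τ →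
      W y τ = cfgExp η A y τ ∧ ‖A y τ‖ ≤ g * ((L : ℝ) ^ j * η)⁻¹ :=
    fun j hj y τ _ => ⟨hWe y τ, (hbd y τ).trans (bound_anti_level₁ hL1 hη hg.le hj)⟩
  have hA0 : ∀ (y : Site d) (τ : Fin d), (∀ j, j ≤ m → ¬ SideTouches ((fun _ : ℕ => (Set.univ : Set (Site d))) j) y τ) → A y τ = 0 :=
    fun y τ h => absurd (sideTouches_univ hd2 y τ) (h 0 (Nat.zero_le _))
  -- THE b9 SOCKET at `(α₀, α₂ := g, U₀, W, A)`
  obtain ⟨h59a, h59g, h59j, h59l, -⟩ := SB9 α₀ g hα₀ hα₀9 hg hg9 U₀ W hU₀ hWu h33m h34W hLan A hsa hWA hA0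
  -- the right side in the spelling of `rhs159`
  set N : ℝ := rhs159 L m η U₀ A with hN_def
  have hN0 : 0 ≤ B₀ * N := mul_nonneg hB₀ (B8Thm2TorusSupplier.rhs159_nonneg L m hη.le U₀ A)
  have hrhs : B₀ * (bondNorm L m η (-(3 : ℝ)) (fun _ => (Set.univ : Set (Site d))) (fun x μ => Jcur η U₀ A μ x)
      + wsup 1 (fun p : {p : ℕ × (Site d × Fin d) // p.1 ≤ m ∧ p.2 ∈ torusLamb (d := d) m p.1} =>
          linCovIter L U₀ (iEta η A) p.1.1 p.1.2.1 p.1.2.2)) = B₀ * N := by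
    rw [hN_def]
    unfold rhs159
    rw [torusLamb_eq_bondsOn]
  have h59a' := h59a.trans_eq hrhs
  have h59g' := h59g.trans_eq hrhs
  have h59j' := h59j.trans_eq hrhs
  have h59l' := h59l.trans_eq hrhs
  -- crude global bounds of the bounded exponent field (for the boundedness side conditions of the weighted suprema)
  have hsc : ∀ {j : ℕ}, j ≤ m → (L : ℝ) ^ j * η ≤ (L : ℝ) ^ m * η :=
    fun hj => mul_le_mul_of_nonneg_right (pow_le_pow_right₀ hLr hj) hη.le
  have hAη : ∀ (y : Site d) (κ : Fin d), ‖A y κ‖ ≤ g * η⁻¹ := by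
    intro y κ
    refine (hbd y κ).trans ?_
    have hLm : (1 : ℝ) ≤ (L : ℝ) ^ m := one_le_pow₀ hLr
    rw [mul_inv]
    calc g * (((L : ℝ) ^ m)⁻¹ * η⁻¹) ≤ g * (1 * η⁻¹) := by gcongr; exact inv_le_one_of_one_le₀ hLm
      _ = g * η⁻¹ := by rw [one_mul]
  have hDA : ∀ (y : Site d) (κ τ : Fin d), ‖covDerivFwd η U₀ κ (fun z => A z τ) y‖ ≤ η⁻¹ * (2 * (g * η⁻¹)) :=
    fun y κ τ => norm_covDerivFwd_le_of_141 hη hU₀1 hAη y κ τ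
  have hw1 : ∀ j, weight L η (-(1 : ℝ)) j = (L : ℝ) ^ j * η := fun j => by
    have e1 : (-(1 : ℝ)) = -((1 : ℕ) : ℝ) := by norm_num
    rw [e1, weight_neg_natCast, pow_one]
  have hw2 : ∀ j, weight L η (-(2 : ℝ)) j = ((L : ℝ) ^ j * η) ^ 2 := fun j => by
    have e2 : (-(2 : ℝ)) = -((2 : ℕ) : ℝ) := by norm_num
    rw [e2, weight_neg_natCast]
  have hw3 : ∀ j, weight L η (-(3 : ℝ)) j = ((L : ℝ) ^ j * η) ^ 3 := fun j => by
    have e3 : (-(3 : ℝ)) = -((3 : ℕ) : ℝ) := by norm_num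
    rw [e3, weight_neg_natCast]
  -- line 1: `(Lᵐη)|A(b)| ≤ B₀N`
  have hBa : Bdd L m η (-(1 : ℝ)) (fun _ (b : Site d × Fin d) => SideTouches (Set.univ : Set (Site d)) b.1 b.2) (fun b => A b.1 b.2) := by
    refine bdd_of_forall (c := (L : ℝ) ^ m * η * (g * ((L : ℝ) ^ m * η)⁻¹)) fun j hj b _ => ?_
    rw [hw1 j]
    exact mul_le_mul (hsc hj) (hbd b.1 b.2) (norm_nonneg _) (scale_pos hL1 hη m).le
  have l1 : ∀ (x : Site d) (κ : Fin d), ((L : ℝ) ^ m * η) * ‖A x κ‖ ≤ B₀ * N := by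
    intro x κ
    have h := weight_mul_norm_le_msup hBa (le_refl m) (i := (x, κ)) (sideTouches_univ hd2 x κ)
    rw [hw1 m] at h
    exact h.trans h59a'
  -- line 2: `(Lᵐη)²|(D^η_{U₀,μ}A_κ)(x)| ≤ B₀N`
  have hBg : Bdd L m η (-(2 : ℝ)) (fun _ (t : Fin d × Fin d × Site d) => SideTouches (Set.univ : Set (Site d)) t.2.2 t.2.1)
      (fun t => covDerivFwd η U₀ t.1 (fun z => A z t.2.1) t.2.2) := by
    refine bdd_of_forall (c := ((L : ℝ) ^ m * η) ^ 2 * (η⁻¹ * (2 * (g * η⁻¹)))) fun j hj t _ => ?_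
    rw [hw2 j]
    exact mul_le_mul (pow_le_pow_left₀ (scale_pos hL1 hη j).le (hsc hj) 2) (hDA _ _ _) (norm_nonneg _) (by positivity)
  have l2 : ∀ (x : Site d) (μ κ : Fin d), ((L : ℝ) ^ m * η) ^ 2 * ‖covDerivFwd η U₀ μ (fun z => A z κ) x‖ ≤ B₀ * N := by
    intro x μ κ
    have h := weight_mul_norm_le_msup hBg (le_refl m) (i := (μ, κ, x)) (sideTouches_univ hd2 x κ)
    rw [hw2 m] at h
    exact h.trans h59g'
  -- line 3: `(Lᵐη)³|(D^{η*}_{U₀}D^η_{U₀}A)(b)| ≤ B₀N`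
  have hP : ∀ (ν κ : Fin d) (y : Site d), ‖plaqCovDeriv η U₀ A ν κ y‖ ≤ 2 * (η⁻¹ * (2 * (g * η⁻¹))) :=
    fun ν κ y => B8Ineq1141SectG.norm_plaqCovDeriv_le U₀ hDA ν κ y
  have hBj : Bdd L m η (-(3 : ℝ)) (fun _ (b : Site d × Fin d) => BondTouches (Set.univ : Set (Site d)) b.1 b.2)
      (fun b => pdiv η U₀ (plaqCovDeriv η U₀ A) b.2 b.1) := by
    refine bdd_of_forall (c := ((L : ℝ) ^ m * η) ^ 3 * (2 * d * (η⁻¹ * (2 * (η⁻¹ * (2 * (g * η⁻¹))) +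
        2 * (η⁻¹ * (2 * (g * η⁻¹))))))) fun j hj b _ => ?_
    rw [hw3 j]
    exact mul_le_mul (pow_le_pow_left₀ (scale_pos hL1 hη j).le (hsc hj) 3) (norm_pdiv_le_of_forall hη hU₀1 hP b.2 b.1) (norm_nonneg _)
      (by positivity)
  have l3 : ∀ (x : Site d) (μ : Fin d), ((L : ℝ) ^ m * η) ^ 3 * ‖pdiv η U₀ (plaqCovDeriv η U₀ A) μ x‖ ≤ B₀ * N := by
    intro x μ
    have h := weight_mul_norm_le_msup hBj (le_refl m) (i := (x, μ)) (Or.inl (Set.mem_univ x))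
    rw [hw3 m] at h
    exact h.trans h59j'
  -- line 4: `(Lᵐη)³|(Δ^η_{U₀}A_κ)(x)| ≤ B₀N`
  have hBl : Bdd L m η (-(3 : ℝ)) (fun _ (b : Site d × Fin d) => BondTouches (Set.univ : Set (Site d)) b.1 b.2)
      (fun b => covLap η U₀ (fun z => A z b.2) b.1) := by
    refine bdd_of_forall (c := ((L : ℝ) ^ m * η) ^ 3 * (d * (η⁻¹ * (η⁻¹ * (2 * (g * η⁻¹)) + η⁻¹ * (2 * (g * η⁻¹))))))
      fun j hj b _ => ?_
    rw [hw3 j]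
    exact mul_le_mul (pow_le_pow_left₀ (scale_pos hL1 hη j).le (hsc hj) 3)
      (norm_covLap_le_of_forall hη hU₀1 (g := fun z => A z b.2) (fun y => hAη y b.2) b.1) (norm_nonneg _) (by positivity)
  have l4 : ∀ (x : Site d) (κ : Fin d), ((L : ℝ) ^ m * η) ^ 3 * ‖covLap η U₀ (fun z => A z κ) x‖ ≤ B₀ * N := by
    intro x κ
    have h := weight_mul_norm_le_msup hBl (le_refl m) (i := (x, κ)) (Or.inl (Set.mem_univ x))
    rw [hw3 m] at h
    exact h.trans h59l'
  refine ⟨l1, l2, l3, l4, ?_⟩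
  -- line 5 at `β = 0`: the plain oscillation from the gradient line at both points (transport isometric)
  intro β' hβ0 hβ1 μ κ q _
  have hβ : β' = 0 := le_antisymm hβ1 hβ0
  subst hβ
  unfold hquot
  rw [add_zero, Real.rpow_two, Real.rpow_zero, div_one]
  calc ((L : ℝ) ^ m * η) ^ 2 * ‖B9Eq340HolderZd.trans U₀ q.1 q.2 (covDerivFwd η U₀ μ (fun z => A z κ) q.2) - covDerivFwd η U₀ μ (fun z => A z κ) q.1‖
      ≤ ((L : ℝ) ^ m * η) ^ 2 * (‖covDerivFwd η U₀ μ (fun z => A z κ) q.2‖ + ‖covDerivFwd η U₀ μ (fun z => A z κ) q.1‖) := by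
        refine mul_le_mul_of_nonneg_left ((norm_sub_le _ _).trans ?_) (by positivity)
        rw [norm_trans hU₀1]
    _ = ((L : ℝ) ^ m * η) ^ 2 * ‖covDerivFwd η U₀ μ (fun z => A z κ) q.2‖
        + ((L : ℝ) ^ m * η) ^ 2 * ‖covDerivFwd η U₀ μ (fun z => A z κ) q.1‖ := mul_add _ _ _
    _ ≤ B₀ * N + B₀ * N := add_le_add (l2 q.2 μ κ) (l2 q.1 μ κ)
    _ = 2 * B₀ * N := by ring

end S159

#print axioms sock142_of135
#print axioms sock142_top
#print axioms sock159_of_sockB9P3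

end Literature.MathematicalPhysics.QuantumFieldTheory.Balaban1983to89.B8Thm2TorusSock142159

end
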